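import Literature.Probability.RandomPlanarGeometry.RadialLoewnerChain
import Mathlib.Analysis.Calculus.Deriv.Star
import Mathlib.Topology.Homeomorph.Lemmas
import HarnessLib

/-!
# Rotation and reflection symmetry of the radial Loewner chain in the unit disc

Topic `Probability/RandomPlanarGeometry`; theorems only, sequel of `RadialLoewnerChain`. The radial
Loewner equation in `𝔻` driven by `U` (driving point `ξₜ = e^{iUₜ}`, `RadialLoewner.Disc`) is
equivariant under the rotations of the disc and under complex conjugation:

* **rotation** by the angle `c`: `g` solves the equation driven by `U` from `z` iff `e^{ic} g`
  solves the equation driven by `U + c` from `e^{ic} z` (`isSolution_rotate_iff`); hence the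
  swallowing times, hulls and domains transform accordingly (`swallowingTime_rotate`,
  `hull_rotate`, `domain_rotate`);
* **reflection**: `g` solves the equation driven by `U` iff `conj ∘ g` solves the equation driven
  by `-U` from `conj z` (`isSolution_conj_iff`; `swallowingTime_conj`, `hull_conj`, `domain_conj`);
* consequently the property "the Loewner domain at time `u` is the connected component of `0` in
  `𝔻 ∖ η([0, u])`" (generation by the curve `η`) is transported along these symmetries
  (`domain_eq_component_rotate`, `domain_eq_component_conj`).

These reductions normalise the driving function (start at `U₀ = 0`, flip the sign), as used when
radial `SLE_κ` statements for the driver `√κ B` are applied to the shifted drivers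
`u ↦ -λ(b + u)` of the whole-plane Markov property (`WholePlaneLoewner.shiftDriver`). Lawler (2005),
§4.2 (the radial equation is stated for an arbitrary continuous driver; rotation invariance of
radial `SLE_κ`, §6.4: "we can give any initial distribution on the Brownian motion").

## References

* G. F. Lawler, *Conformally Invariant Processes in the Plane*, AMS (2005), §4.2, §6.4. [Lawler2005]
-/

noncomputable section

open Set Filter Topology Complex Metric
open scoped NNReal ComplexConjugate

namespace Literature.Probability.RandomPlanarGeometry

namespace RadialLoewner

namespace Disc

variable {U : ℝ≥0 → ℝ} {z : ℂ} {g : ℝ → ℂ} {T : WithTop ℝ≥0}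

/-! ### Rotations -/

section Rotation

/-- The rotation factor `e^{ic}` is nonzero. [folklore] -/
theorem exp_mul_I_ne_zero (c : ℝ) : Complex.exp (c * Complex.I) ≠ 0 := Complex.exp_ne_zero _

/-- `e^{-ic} e^{ic} = 1`. [folklore] -/
theorem exp_neg_mul_I_mul (c : ℝ) : Complex.exp ((-c : ℝ) * Complex.I) * Complex.exp (c * Complex.I) = 1 := by
  rw [← Complex.exp_add]
  push_cast
  rw [show -(c : ℂ) * Complex.I + c * Complex.I = 0 by ring, Complex.exp_zero]

/-- The driving point of the rotated driver: `ξ'ₜ = e^{ic} ξₜ`. [folklore] -/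
theorem drivingPt_add_const (c t : ℝ) :
    drivingPt (fun u ↦ U u + c) t = Complex.exp (c * Complex.I) * drivingPt U t := by
  rw [drivingPt_apply, drivingPt_apply, ← Complex.exp_add]
  congr 1
  push_cast
  ring

/-- The radial field is rotation equivariant: `F'(t, e^{ic} w) = e^{ic} F(t, w)`. [folklore] -/
theorem field_add_const (c t : ℝ) (w : ℂ) :
    field (fun u ↦ U u + c) t (Complex.exp (c * Complex.I) * w) =
      Complex.exp (c * Complex.I) * field U t w := by
  rw [field_apply, field_apply, drivingPt_add_const]
  set ζ := Complex.exp (c * Complex.I) with hζ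
  set ξ := drivingPt U t
  have hζ0 : ζ ≠ 0 := exp_mul_I_ne_zero c
  rw [show ζ * w * (ζ * ξ + ζ * w) / (ζ * ξ - ζ * w) = ζ * (ζ * (w * (ξ + w)) / (ζ * (ξ - w))) by ring,
    mul_div_mul_left _ _ hζ0, mul_div_assoc]

/-- **Rotating a solution**: if `g` solves the radial equation driven by `U` from `z`, then
`e^{ic} g` solves the equation driven by `U + c` from `e^{ic} z`. [cite: Lawler2005, §4.2] -/
theorem IsSolution.rotate (h : IsSolution U z g T) (c : ℝ) :
    IsSolution (fun u ↦ U u + c) (Complex.exp (c * Complex.I) * z)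
      (fun t ↦ Complex.exp (c * Complex.I) * g t) T := by
  refine ⟨by beta_reduce; rw [h.apply_zero], fun t ht ↦ ?_, fun t ht htT heq ↦ ?_⟩
  · have := (h.isIntegralCurveOn t ht).const_mul (Complex.exp (c * Complex.I))
    rwa [← field_add_const] at this
  · rw [drivingPt_add_const] at heq
    exact h.ne ht htT (mul_left_cancel₀ (exp_mul_I_ne_zero c) heq)

/-- Rotating back. [folklore] -/
theorem IsSolution.of_rotate (c : ℝ)
    (h : IsSolution (fun u ↦ U u + c) (Complex.exp (c * Complex.I) * z)
      (fun t ↦ Complex.exp (c * Complex.I) * g t) T) :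
    IsSolution U z g T := by
  have h' := h.rotate (-c)
  have hU : (fun u ↦ U u + c + -c) = U := funext fun u ↦ by ring
  have hz : Complex.exp ((-c : ℝ) * Complex.I) * (Complex.exp (c * Complex.I) * z) = z := by
    rw [← mul_assoc, exp_neg_mul_I_mul, one_mul]
  have hg : (fun t ↦ Complex.exp ((-c : ℝ) * Complex.I) * (Complex.exp (c * Complex.I) * g t)) = g :=
    funext fun t ↦ by rw [← mul_assoc, exp_neg_mul_I_mul, one_mul]
  rwa [hU, hz, hg] at h'

/-- **Rotation equivariance of solutions.** [cite: Lawler2005, §4.2] -/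
theorem isSolution_rotate_iff (c : ℝ) :
    IsSolution (fun u ↦ U u + c) (Complex.exp (c * Complex.I) * z)
      (fun t ↦ Complex.exp (c * Complex.I) * g t) T ↔ IsSolution U z g T :=
  ⟨IsSolution.of_rotate c, fun h ↦ h.rotate c⟩

/-- **The swallowing time is rotation invariant**: `T'_{e^{ic} z} = T_z`. [cite: Lawler2005, §4.2] -/
theorem swallowingTime_rotate (U : ℝ≥0 → ℝ) (c : ℝ) (z : ℂ) :
    swallowingTime (fun u ↦ U u + c) (Complex.exp (c * Complex.I) * z) = swallowingTime U z := by
  apply le_antisymm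
  · refine sSup_le fun T' ⟨g', hg'⟩ ↦ le_sSup ⟨fun t ↦ Complex.exp ((-c : ℝ) * Complex.I) * g' t, ?_⟩
    refine IsSolution.of_rotate c ?_
    have hg : (fun t ↦ Complex.exp (c * Complex.I) * (Complex.exp ((-c : ℝ) * Complex.I) * g' t)) = g' := by
      funext t
      rw [← mul_assoc, mul_comm (Complex.exp _), exp_neg_mul_I_mul, one_mul]
    rwa [hg]
  · exact sSup_le fun T' ⟨g', hg'⟩ ↦ le_sSup ⟨_, hg'.rotate c⟩

/-- Rotation invariance of the swallowing time, preimage form. [folklore] -/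
theorem swallowingTime_rotate' (U : ℝ≥0 → ℝ) (c : ℝ) (w : ℂ) :
    swallowingTime (fun u ↦ U u + c) w = swallowingTime U (Complex.exp ((-c : ℝ) * Complex.I) * w) := by
  conv_lhs => rw [show w = Complex.exp (c * Complex.I) * (Complex.exp ((-c : ℝ) * Complex.I) * w) by
    rw [← mul_assoc, mul_comm (Complex.exp _), exp_neg_mul_I_mul, one_mul]]
  exact swallowingTime_rotate U c _

/-- **The hulls rotate**: `K'ₜ = e^{ic} Kₜ`. [cite: Lawler2005, §4.2] -/
theorem hull_rotate (U : ℝ≥0 → ℝ) (c : ℝ) (t : ℝ≥0) :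
    hull (fun u ↦ U u + c) t = (fun z ↦ Complex.exp (c * Complex.I) * z) '' hull U t := by
  ext w
  simp only [hull, mem_setOf_eq, mem_image, mem_ball_zero_iff]
  constructor
  · rintro ⟨hw, hT⟩
    refine ⟨Complex.exp ((-c : ℝ) * Complex.I) * w, ⟨?_, ?_⟩, ?_⟩
    · rwa [norm_mul, Complex.norm_exp_ofReal_mul_I, one_mul]
    · rwa [← swallowingTime_rotate']
    · rw [← mul_assoc, mul_comm (Complex.exp _), exp_neg_mul_I_mul, one_mul]
  · rintro ⟨z, ⟨hz, hT⟩, rfl⟩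
    refine ⟨by rwa [norm_mul, Complex.norm_exp_ofReal_mul_I, one_mul], ?_⟩
    rwa [swallowingTime_rotate]

/-- Rotations preserve the unit disc. [folklore] -/
theorem image_rotate_ball (c : ℝ) :
    (fun z ↦ Complex.exp (c * Complex.I) * z) '' ball (0 : ℂ) 1 = ball (0 : ℂ) 1 := by
  ext w
  simp only [mem_image, mem_ball_zero_iff]
  constructor
  · rintro ⟨z, hz, rfl⟩
    rwa [norm_mul, Complex.norm_exp_ofReal_mul_I, one_mul]
  · intro hw
    refine ⟨Complex.exp ((-c : ℝ) * Complex.I) * w, by rwa [norm_mul, Complex.norm_exp_ofReal_mul_I, one_mul], ?_⟩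
    rw [← mul_assoc, mul_comm (Complex.exp _), exp_neg_mul_I_mul, one_mul]

/-- Rotations are injective. [folklore] -/
theorem injective_rotate (c : ℝ) : Function.Injective fun z : ℂ ↦ Complex.exp (c * Complex.I) * z :=
  mul_right_injective₀ (exp_mul_I_ne_zero c)

/-- **The domains rotate**: `U'ₜ = e^{ic} Uₜ`. [cite: Lawler2005, §4.2] -/
theorem domain_rotate (U : ℝ≥0 → ℝ) (c : ℝ) (t : ℝ≥0) :
    domain (fun u ↦ U u + c) t = (fun z ↦ Complex.exp (c * Complex.I) * z) '' domain U t := by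
  rw [domain, domain, image_sdiff (injective_rotate c), image_rotate_ball, hull_rotate]

/-- The rotation as a homeomorphism of `ℂ`. [folklore] -/
theorem coe_mulLeft₀_rotate (c : ℝ) :
    ⇑(Homeomorph.mulLeft₀ (Complex.exp (c * Complex.I)) (exp_mul_I_ne_zero c)) =
      fun z ↦ Complex.exp (c * Complex.I) * z := rfl

/-- **Transport of generation by a curve under rotations.** If the Loewner domain of `U` at time
`u` is the component of `0` in `𝔻 ∖ η(S)`, then the Loewner domain of `U + c` at time `u` is the
component of `0` in `𝔻 ∖ e^{ic} η(S)`. [cite: Lawler2005, §6.4] -/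
theorem domain_eq_component_rotate {U : ℝ≥0 → ℝ} {u : ℝ≥0} {η : ℝ≥0 → ℂ} {S : Set ℝ≥0}
    (h : domain U u = connectedComponentIn (ball (0 : ℂ) 1 \ η '' S) 0) (c : ℝ) :
    domain (fun v ↦ U v + c) u =
      connectedComponentIn (ball (0 : ℂ) 1 \ (fun v ↦ Complex.exp (c * Complex.I) * η v) '' S) 0 := by
  rw [domain_rotate, h]
  by_cases h0 : (0 : ℂ) ∈ ball (0 : ℂ) 1 \ η '' S
  · have := (Homeomorph.mulLeft₀ (Complex.exp (c * Complex.I)) (exp_mul_I_ne_zero c)).image_connectedComponentIn h0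
    rw [coe_mulLeft₀_rotate] at this
    rw [this]
    congr 1
    · rw [image_sdiff (injective_rotate c), image_rotate_ball, ← image_comp]
      rfl
    · exact mul_zero _
  · rw [connectedComponentIn_eq_empty h0, image_empty, eq_comm, connectedComponentIn_eq_empty]
    rintro ⟨h0', hn⟩
    refine h0 ⟨mem_ball_self one_pos, ?_⟩
    rintro ⟨v, hv, hv0⟩
    exact hn ⟨v, hv, by simp [hv0]⟩

end Rotation

/-! ### Reflection (complex conjugation) -/

section Reflection

/-- The driving point of the reflected driver: `ξ'ₜ = conj ξₜ`. [folklore] -/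
theorem drivingPt_neg (t : ℝ) : drivingPt (fun u ↦ -U u) t = conj (drivingPt U t) := by
  rw [drivingPt_apply, drivingPt_apply, ← Complex.exp_conj]
  congr 1
  rw [map_mul, Complex.conj_ofReal, Complex.conj_I]
  push_cast
  ring

/-- The radial field is reflection equivariant: `F'(t, conj w) = conj F(t, w)`. [folklore] -/
theorem field_neg (t : ℝ) (w : ℂ) : field (fun u ↦ -U u) t (conj w) = conj (field U t w) := by
  rw [field_apply, field_apply, drivingPt_neg, map_div₀, map_mul, map_add, map_sub]

/-- **Reflecting a solution**: if `g` solves the radial equation driven by `U` from `z`, then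
`conj ∘ g` solves the equation driven by `-U` from `conj z`. [cite: Lawler2005, §4.2] -/
theorem IsSolution.conj (h : IsSolution U z g T) :
    IsSolution (fun u ↦ -U u) (conj z) (fun t ↦ conj (g t)) T := by
  refine ⟨by beta_reduce; rw [h.apply_zero], fun t ht ↦ ?_, fun t ht htT heq ↦ ?_⟩
  · have := (h.isIntegralCurveOn t ht).star
    simp only [← starRingEnd_apply] at this
    rwa [← field_neg] at this
  · rw [drivingPt_neg] at heq
    exact h.ne ht htT ((starRingEnd ℂ).injective heq)

/-- **Reflection equivariance of solutions.** [cite: Lawler2005, §4.2] -/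
theorem isSolution_conj_iff :
    IsSolution (fun u ↦ -U u) (conj z) (fun t ↦ conj (g t)) T ↔ IsSolution U z g T := by
  refine ⟨fun h ↦ ?_, IsSolution.conj⟩
  have h' := h.conj
  have hU : (fun u ↦ -(-U u)) = U := funext fun u ↦ by ring
  simp only [Complex.conj_conj] at h'
  rwa [hU] at h'

/-- **The swallowing time is reflection invariant**: `T'_{conj z} = T_z`. [cite: Lawler2005, §4.2] -/
theorem swallowingTime_conj (U : ℝ≥0 → ℝ) (z : ℂ) :
    swallowingTime (fun u ↦ -U u) (conj z) = swallowingTime U z := by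
  apply le_antisymm
  · refine sSup_le fun T' ⟨g', hg'⟩ ↦ le_sSup ⟨fun t ↦ conj (g' t), ?_⟩
    refine isSolution_conj_iff.1 ?_
    simpa only [Complex.conj_conj] using hg'
  · exact sSup_le fun T' ⟨g', hg'⟩ ↦ le_sSup ⟨_, hg'.conj⟩

/-- Reflection invariance of the swallowing time, preimage form. [folklore] -/
theorem swallowingTime_conj' (U : ℝ≥0 → ℝ) (w : ℂ) :
    swallowingTime (fun u ↦ -U u) w = swallowingTime U (conj w) := by
  conv_lhs => rw [← Complex.conj_conj w]
  exact swallowingTime_conj U _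

/-- **The hulls reflect**: `K'ₜ = conj Kₜ`. [cite: Lawler2005, §4.2] -/
theorem hull_conj (U : ℝ≥0 → ℝ) (t : ℝ≥0) :
    hull (fun u ↦ -U u) t = (fun z ↦ conj z) '' hull U t := by
  ext w
  simp only [hull, mem_setOf_eq, mem_image, mem_ball_zero_iff]
  constructor
  · rintro ⟨hw, hT⟩
    refine ⟨conj w, ⟨by rwa [Complex.norm_conj], by rwa [← swallowingTime_conj']⟩, Complex.conj_conj w⟩
  · rintro ⟨z, ⟨hz, hT⟩, rfl⟩
    exact ⟨by rwa [Complex.norm_conj], by rwa [swallowingTime_conj]⟩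

/-- Conjugation preserves the unit disc. [folklore] -/
theorem image_conj_ball : (fun z ↦ conj z) '' ball (0 : ℂ) 1 = ball (0 : ℂ) 1 := by
  ext w
  simp only [mem_image, mem_ball_zero_iff]
  exact ⟨fun ⟨z, hz, hzw⟩ ↦ by rw [← hzw, Complex.norm_conj]; exact hz,
    fun hw ↦ ⟨conj w, by rwa [Complex.norm_conj], Complex.conj_conj w⟩⟩

/-- **The domains reflect**: `U'ₜ = conj Uₜ`. [cite: Lawler2005, §4.2] -/
theorem domain_conj (U : ℝ≥0 → ℝ) (t : ℝ≥0) :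
    domain (fun u ↦ -U u) t = (fun z ↦ conj z) '' domain U t := by
  rw [domain, domain, image_sdiff (starRingEnd ℂ).injective, image_conj_ball, hull_conj]

/-- Conjugation as a homeomorphism of `ℂ`. [folklore] -/
theorem coe_conjCLE_toHomeomorph : ⇑(Complex.conjCLE.toHomeomorph) = fun z ↦ conj z := rfl

/-- **Transport of generation by a curve under reflection.** [cite: Lawler2005, §6.4] -/
theorem domain_eq_component_conj {U : ℝ≥0 → ℝ} {u : ℝ≥0} {η : ℝ≥0 → ℂ} {S : Set ℝ≥0}
    (h : domain U u = connectedComponentIn (ball (0 : ℂ) 1 \ η '' S) 0) :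
    domain (fun v ↦ -U v) u =
      connectedComponentIn (ball (0 : ℂ) 1 \ (fun v ↦ conj (η v)) '' S) 0 := by
  rw [domain_conj, h]
  by_cases h0 : (0 : ℂ) ∈ ball (0 : ℂ) 1 \ η '' S
  · have := Complex.conjCLE.toHomeomorph.image_connectedComponentIn h0
    rw [coe_conjCLE_toHomeomorph] at this
    rw [this]
    congr 1
    · rw [image_sdiff (starRingEnd ℂ).injective, image_conj_ball, ← image_comp]
      rfl
    · exact map_zero _
  · rw [connectedComponentIn_eq_empty h0, image_empty, eq_comm, connectedComponentIn_eq_empty]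
    rintro ⟨h0', hn⟩
    refine h0 ⟨mem_ball_self one_pos, ?_⟩
    rintro ⟨v, hv, hv0⟩
    exact hn ⟨v, hv, by simp [hv0]⟩

end Reflection

end Disc

end RadialLoewner

end Literature.Probability.RandomPlanarGeometry
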